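import Literature.Probability.LatticeModels.ONModelDobrushinStates
import HarnessLib

/-!
# The O(N) model in Dobrushin's regime: decay of covariances

Sibling proof file of `Literature/Probability/LatticeModels/ONModel.lean` and
`ONModelDobrushinStates.lean`. No definition and no named fact is introduced (D-0026); everything
here is proved.

In Dobrushin's regime `c := D (e^{4|β|} - 1) ≤ 1` (degrees `≤ D`), the comparison ("dusting")
estimate already in the tree (`Dobrushin.DustingData.abs_sub_le_sum_pow`, Friedli–Velenik 2017,
Thm. 6.31 with Prop. 6.33; Georgii 2011, Thm. 8.20 / Remark 8.26), applied to a Gibbs measure `μ`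
and its tilt `μ_g = g μ / μ(g)` by a nonnegative bounded local density `g`
(`isInvariantState_tilt`, the device of Georgii 2011, §8.2 / Künsch 1982), bounds covariances:

* `abs_covariance_le_of_isGibbsMeasure`: for bounded measurable local `f` (dependence set `Δf`,
  oscillation bound `δ`) and `g ≥ 0` bounded measurable depending only on `Δg`, and every profile
  `ℓ : V → ℕ` vanishing on `Δg` and `1`-Lipschitz along edges,
  `|μ(g f) - μ(g) μ(f)| ≤ μ(g) ∑_{y ∈ Δf} c^{min n (ℓ y)} δ y` (Georgii 2011, Cor. 8.32-type
  covariance estimate; Friedli–Velenik 2017, Thm. 6.31 / Prop. 6.33 machinery).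
* `abs_covariance_spin_le`: on `ℤ^d` (`D = 2d`), for the spin coordinates `s ↦ (s x)_i`,
  `s ↦ (s y)_j`: `|μ((s x)_i (s y)_j) - μ((s x)_i) μ((s y)_j)| ≤ 6 c^{‖y - x‖_∞}` — exponential
  decay of the truncated two-point function with rate `-log c` in the sup norm when `c < 1`.

## References

* S. Friedli, Y. Velenik, *Statistical Mechanics of Lattice Systems*, CUP (2017), Thm. 6.31,
  Prop. 6.33, Lemma 6.34 (pp. 287–290), Example 6.36.
* H.-O. Georgii, *Gibbs Measures and Phase Transitions*, 2nd ed. (2011), §8.1–8.2: Thm. 8.7,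
  Prop. 8.8, Thm. 8.20, Remark 8.26, Cor. 8.32 (as cited by the sibling files; not re-read here).
* H. Künsch, *Decay of correlations under Dobrushin's uniqueness condition and its applications*,
  Comm. Math. Phys. 84 (1982) 207–222 (context).
-/

noncomputable section

open MeasureTheory Finset Function
open scoped RealInnerProductSpace

namespace Literature.Probability.LatticeModels

variable {V : Type*} {N : ℕ}

section General

variable (G : SimpleGraph V) [DecidableEq V] [G.LocallyFinite] [DecidableRel G.Adj] [NeZero N]
  [Countable V]

/-- **Covariance estimate in Dobrushin's regime for the O(N) model** (Georgii 2011, Thm. 8.20 with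
Remark 8.26 and Cor. 8.32; Friedli–Velenik 2017, Thm. 6.31 / Prop. 6.33): let `μ ∈ 𝒢(γ^{O(N)}_β)`
on a countable locally finite graph with degrees `≤ D` and `c := D (e^{4|β|} - 1) ≤ 1`. For a
bounded measurable `f` depending only on the spins in `Δf` with oscillation bound `δ`, a bounded
measurable `g ≥ 0` depending only on the spins in `Δg`, and a profile `ℓ : V → ℕ` vanishing on
`Δg` with `ℓ x ≤ ℓ y + 1` for adjacent `x ∉ Δg`, `y`:
`|μ(g f) - μ(g) μ(f)| ≤ μ(g) ∑_{y ∈ Δf} c ^ min n (ℓ y) · δ y` for every `n`. (Comparison of the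
two invariant states `μ` and `μ_g = g μ / μ(g)` of the dusting data with usable sites `V ∖ Δg`.)
[cite: Georgii2011, Thm. 8.20 / Cor. 8.32] [cite: FriedliVelenik2017, Thm. 6.31 with Prop. 6.33] -/
theorem abs_covariance_le_of_isGibbsMeasure (β : ℝ) {D : ℕ} (hdeg : ∀ x, G.degree x ≤ D)
    (hc1 : D * onDobrushinCoeff β ≤ 1) {μ : Measure (ONConfig V N)}
    (hμ : IsGibbsMeasure (onSpecification G β) μ)
    {f : ONConfig V N → ℝ} (hfm : Measurable f) {Δf : Finset V} (hfdep : DependsOn f (↑Δf : Set V))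
    {M : ℝ} (hfM : ∀ σ, |f σ| ≤ M) {δ : V → ℝ} (hδ : Dobrushin.IsOscBound f δ)
    (hδ0 : ∀ y ∉ Δf, δ y = 0)
    {g : ONConfig V N → ℝ} (hgm : Measurable g) {Δg : Finset V} (hgdep : DependsOn g (↑Δg : Set V))
    (hg0 : ∀ σ, 0 ≤ g σ) {B : ℝ} (hgB : ∀ σ, g σ ≤ B)
    (ℓ : V → ℕ) (hℓ0 : ∀ y ∈ Δg, ℓ y = 0)
    (hℓ : ∀ x ∉ Δg, ∀ y, G.Adj x y → ℓ x ≤ ℓ y + 1) (n : ℕ) :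
    |∫ σ, g σ * f σ ∂μ - (∫ σ, g σ ∂μ) * ∫ σ, f σ ∂μ| ≤
      (∫ σ, g σ ∂μ) * ∑ y ∈ Δf, (D * onDobrushinCoeff β) ^ min n (ℓ y) * δ y := by
  haveI := hμ.isProbabilityMeasure
  have hc0 : 0 ≤ (D : ℝ) * onDobrushinCoeff β :=
    mul_nonneg (Nat.cast_nonneg D) (onDobrushinCoeff_nonneg β)
  have hS0 : 0 ≤ ∑ y ∈ Δf, ((D : ℝ) * onDobrushinCoeff β) ^ min n (ℓ y) * δ y :=
    Finset.sum_nonneg fun y _ => mul_nonneg (pow_nonneg hc0 _) (hδ.nonneg y)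
  have hgint : 0 ≤ ∫ σ, g σ ∂μ := integral_nonneg hg0
  rcases hgint.eq_or_lt with hzero | hpos
  · -- `μ(g) = 0`: then `g = 0` a.e., both sides vanish
    have hgabs : ∀ σ, |g σ| ≤ B := fun σ => by rw [abs_of_nonneg (hg0 σ)]; exact hgB σ
    have hgi : Integrable g μ := integrable_of_abs_le hgm hgabs
    have hae : g =ᵐ[μ] 0 := (integral_eq_zero_iff_of_nonneg_ae (ae_of_all _ hg0) hgi).1 hzero.symm
    have hgf : ∫ σ, g σ * f σ ∂μ = 0 := by
      have h0 : (fun σ => g σ * f σ) =ᵐ[μ] fun _ => 0 := by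
        filter_upwards [hae] with σ hσ
        simp [hσ]
      rw [integral_congr_ae h0, integral_const, smul_zero]
    rw [hgf, ← hzero]
    simp
  · -- `μ(g) > 0`: compare the invariant states `μ_g` and `μ` of the dusting data off `Δg`
    set Dd := onDustingData G β ((↑Δg : Set V)ᶜ) (N := N) with hDd
    have h₁ := isInvariantState_tilt G β hμ hgm hgdep hg0 hgB hpos
    have h₂ := isInvariantState_integral_of_isGibbsMeasure G β ((↑Δg : Set V)ᶜ) hμ
    have hrow : ∀ x ∈ Dd.W, ∑ y ∈ Dd.nbr x, Dd.C x y ≤ D * onDobrushinCoeff β :=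
      fun x _ => sum_onDustingCoeff_le G β _ hdeg x
    have hℓW : ∀ y ∉ Dd.W, ℓ y = 0 := fun y hy => hℓ0 y (by
      simpa [hDd, onDustingData, Set.mem_compl_iff] using hy)
    have hℓ' : ∀ x ∈ Dd.W, ∀ y ∈ Dd.nbr x, ℓ x ≤ ℓ y + 1 := fun x hx y hy => by
      have hx' : x ∉ Δg := by simpa [hDd, onDustingData, Set.mem_compl_iff] using hx
      have hy' : G.Adj x y := by simpa [hDd, onDustingData, SimpleGraph.mem_neighborFinset] using hy
      exact hℓ x hx' y hy'
    have hP : Dd.P f Δf := ⟨hfm, hfdep, M, hfM⟩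
    have key := Dd.abs_sub_le_sum_pow h₁ h₂ hc0 hc1 hrow ℓ hℓW hℓ' hP hδ hδ0 n
    -- `|μ_g(f) - μ(f)| ≤ S`; multiply by `μ(g) > 0`
    have hmul := mul_le_mul_of_nonneg_left key hpos.le
    have hid : (∫ σ, g σ ∂μ) * ((∫ σ, g σ * f σ ∂μ) / (∫ σ, g σ ∂μ) - ∫ σ, f σ ∂μ) =
        ∫ σ, g σ * f σ ∂μ - (∫ σ, g σ ∂μ) * ∫ σ, f σ ∂μ := by
      field_simp
    calc |∫ σ, g σ * f σ ∂μ - (∫ σ, g σ ∂μ) * ∫ σ, f σ ∂μ|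
        = |(∫ σ, g σ ∂μ) * ((∫ σ, g σ * f σ ∂μ) / (∫ σ, g σ ∂μ) - ∫ σ, f σ ∂μ)| := by rw [hid]
      _ = (∫ σ, g σ ∂μ) * |(∫ σ, g σ * f σ ∂μ) / (∫ σ, g σ ∂μ) - ∫ σ, f σ ∂μ| := by
          rw [abs_mul, abs_of_pos hpos]
      _ ≤ (∫ σ, g σ ∂μ) * ∑ y ∈ Δf, (D * onDobrushinCoeff β) ^ min n (ℓ y) * δ y := hmul

end General

/-! ### Spin coordinates on `ℤ^d`: decay of the truncated two-point function -/

section Zd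

variable {d : ℕ}

/-- The sup-distance profile to `x`, `y ↦ max_j |y_j - x_j| ∈ ℕ`, vanishes at `x`. [folklore] -/
private theorem onCov_supDist_self (x : Site d) :
    (Finset.univ.sup fun j => (x j - x j).natAbs) = 0 := by
  simp

/-- The sup-distance profile is `1`-Lipschitz along the edges of `ℤ^d`. [folklore] -/
private theorem onCov_supDist_adj (x : Site d) {y z : Site d} (h : (zdGraph d).Adj y z) :
    (Finset.univ.sup fun j => (y j - x j).natAbs) ≤
      (Finset.univ.sup fun j => (z j - x j).natAbs) + 1 := by
  refine Finset.sup_le fun j _ => ?_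
  have hz : (z j - x j).natAbs ≤ Finset.univ.sup fun j => (z j - x j).natAbs :=
    Finset.le_sup (f := fun j => (z j - x j).natAbs) (Finset.mem_univ j)
  have hyz : (y j - z j).natAbs ≤ 1 := by
    obtain ⟨i, h | h⟩ := (zdGraph_adj_iff y z).1 h
    · rw [h]
      by_cases hij : j = i
      · subst hij; simp
      · simp [hij]
    · rw [h]
      by_cases hij : j = i
      · subst hij; simp
      · simp [hij]
  have htri : (y j - x j).natAbs ≤ (y j - z j).natAbs + (z j - x j).natAbs := by
    have : y j - x j = (y j - z j) + (z j - x j) := by ring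
    rw [this]
    exact Int.natAbs_add_le _ _
  omega

/-- The sup norm is dominated by the sup-distance profile: `‖y - x‖ ≤ max_j |y_j - x_j|`
(in fact equal). [folklore] -/
private theorem onCov_norm_sub_le_supDist (x y : Site d) :
    ‖y - x‖ ≤ ((Finset.univ.sup fun j => (y j - x j).natAbs : ℕ) : ℝ) := by
  refine (pi_norm_le_iff_of_nonneg (Nat.cast_nonneg _)).2 fun j => ?_
  have h1 : ((y j - x j).natAbs : ℤ) ≤
      ((Finset.univ.sup fun j => (y j - x j).natAbs : ℕ) : ℤ) := by
    exact_mod_cast Finset.le_sup (f := fun j => (y j - x j).natAbs) (Finset.mem_univ j)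
  rw [Int.natCast_natAbs] at h1
  rw [Pi.sub_apply, Int.norm_eq_abs, ← Int.cast_abs]
  exact_mod_cast h1

/-- The spin coordinate `s ↦ (s x)_i` is measurable. [folklore] -/
private theorem onCov_measurable_spinCoord (x : Site d) (i : Fin N) :
    Measurable fun s : ONConfig (Site d) N => (s x : EuclideanSpace ℝ (Fin N)) i := by
  have h : Continuous fun s : ONConfig (Site d) N => (s x : EuclideanSpace ℝ (Fin N)) :=
    (continuous_apply x).subtype_val
  have h2 : Continuous fun s : ONConfig (Site d) N =>
      (EuclideanSpace.proj i : EuclideanSpace ℝ (Fin N) →L[ℝ] ℝ) (s x : EuclideanSpace ℝ (Fin N)) :=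
    (EuclideanSpace.proj i).continuous.comp h
  exact h2.measurable

/-- `|(s x)_i| ≤ 1` for a unit spin. [folklore] -/
private theorem onCov_abs_spinCoord_le (s : ONConfig (Site d) N) (x : Site d) (i : Fin N) :
    |(s x : EuclideanSpace ℝ (Fin N)) i| ≤ 1 := by
  have h := PiLp.norm_apply_le (s x : EuclideanSpace ℝ (Fin N)) i
  rw [Real.norm_eq_abs] at h
  exact h.trans (by simp)

/-- The spin coordinate `s ↦ (s x)_i` depends only on the spin at `x`. [folklore] -/
private theorem onCov_dependsOn_spinCoord (x : Site d) (i : Fin N) :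
    DependsOn (fun s : ONConfig (Site d) N => (s x : EuclideanSpace ℝ (Fin N)) i)
      (↑({x} : Finset (Site d)) : Set (Site d)) :=
  fun σ τ h => by simp [h x (by simp)]

variable [NeZero N]

/-- **Exponential decay of the truncated two-point function of the O(N) model on `ℤ^d` in
Dobrushin's regime** (Georgii 2011, Cor. 8.32 / Thm. 8.20; Friedli–Velenik 2017, Thm. 6.31 with
Prop. 6.33 and Example 6.36): if `c := 2d (e^{4|β|} - 1) ≤ 1` then for every Gibbs measure `μ`
of the O(N) model on `ℤ^d` at inverse temperature `β`, all sites `x, y` and coordinates `i, j`,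
`|μ((s x)_i (s y)_j) - μ((s x)_i) μ((s y)_j)| ≤ 6 c ^ ‖y - x‖_∞` (the exponent is the sup
distance, as a natural number). [cite: Georgii2011, Cor. 8.32] [cite: FriedliVelenik2017, Thm. 6.31 with Prop. 6.33] -/
theorem abs_covariance_spin_le (d : ℕ) {β : ℝ} (hc1 : (2 * d : ℕ) * onDobrushinCoeff β ≤ 1)
    {μ : Measure (ONConfig (Site d) N)} (hμ : IsGibbsMeasure (onSpecification (zdGraph d) β) μ)
    (x y : Site d) (i j : Fin N) :
    |∫ s, (s x : EuclideanSpace ℝ (Fin N)) i * (s y : EuclideanSpace ℝ (Fin N)) j ∂μ -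
        (∫ s, (s x : EuclideanSpace ℝ (Fin N)) i ∂μ) *
          ∫ s, (s y : EuclideanSpace ℝ (Fin N)) j ∂μ| ≤
      6 * ((2 * d : ℕ) * onDobrushinCoeff β) ^ (Finset.univ.sup fun k => (y k - x k).natAbs) := by
  classical
  haveI := hμ.isProbabilityMeasure
  set a : ONConfig (Site d) N → ℝ := fun s => (s x : EuclideanSpace ℝ (Fin N)) i with ha
  set f : ONConfig (Site d) N → ℝ := fun s => (s y : EuclideanSpace ℝ (Fin N)) j with hf
  set ℓ : Site d → ℕ := fun z => Finset.univ.sup fun k => (z k - x k).natAbs with hℓ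
  set c : ℝ := (2 * d : ℕ) * onDobrushinCoeff β with hc
  have ham : Measurable a := onCov_measurable_spinCoord x i
  have hfm : Measurable f := onCov_measurable_spinCoord y j
  have ha1 : ∀ s, |a s| ≤ 1 := fun s => onCov_abs_spinCoord_le s x i
  have hf1 : ∀ s, |f s| ≤ 1 := fun s => onCov_abs_spinCoord_le s y j
  -- the tilt density `g = 2 + (s x)_i ∈ [1, 3]`
  have hg0 : ∀ s, 0 ≤ 2 + a s := fun s => by have := (abs_le.1 (ha1 s)).1; linarith
  have hg3 : ∀ s, 2 + a s ≤ 3 := fun s => by have := (abs_le.1 (ha1 s)).2; linarith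
  have hgm : Measurable fun s => 2 + a s := measurable_const.add ham
  have hgdep : DependsOn (fun s => 2 + a s) (↑({x} : Finset (Site d)) : Set (Site d)) :=
    fun σ τ h => by simp [ha, h x (by simp)]
  have hδ : Dobrushin.IsOscBound f fun z => if z ∈ ({y} : Finset (Site d)) then 2 * 1 else 0 :=
    (Dobrushin.IsOscBound.of_abs_le zero_le_one hf1).restrict (onCov_dependsOn_spinCoord y j)
  have hdeg : ∀ z, (zdGraph d).degree z ≤ 2 * d := fun z =>
    ((SimpleGraph.card_neighborFinset_eq_degree _ z).symm.trans_le
      (card_neighborFinset_zdGraph_holds z).le)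
  have key := abs_covariance_le_of_isGibbsMeasure (zdGraph d) β hdeg hc1 hμ hfm
    (onCov_dependsOn_spinCoord y j) hf1 hδ (fun z hz => if_neg hz) hgm hgdep hg0 hg3 ℓ
    (fun z hz => by rw [Finset.mem_singleton.1 hz]; exact onCov_supDist_self x)
    (fun z _ w hzw => onCov_supDist_adj x hzw) (ℓ y)
  -- left-hand side: the constants cancel
  have hai : Integrable a μ := integrable_of_abs_le ham ha1
  have hfi : Integrable f μ := integrable_of_abs_le hfm hf1
  have hafi : Integrable (fun s => a s * f s) μ :=
    hai.mul_bdd hfm.aestronglyMeasurable (ae_of_all _ fun s => by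
      rw [Real.norm_eq_abs]; exact hf1 s)
  have hL1 : ∫ s, (2 + a s) * f s ∂μ = 2 * ∫ s, f s ∂μ + ∫ s, a s * f s ∂μ := by
    have : (fun s => (2 + a s) * f s) = fun s => 2 * f s + a s * f s := funext fun s => by ring
    rw [this, integral_add (hfi.const_mul 2) hafi, integral_const_mul]
  have hL2 : ∫ s, (2 + a s) ∂μ = 2 + ∫ s, a s ∂μ := by
    rw [integral_add (integrable_const _) hai]
    simp
  have hlhs : ∫ s, (2 + a s) * f s ∂μ - (∫ s, (2 + a s) ∂μ) * ∫ s, f s ∂μ =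
      ∫ s, a s * f s ∂μ - (∫ s, a s ∂μ) * ∫ s, f s ∂μ := by
    rw [hL1, hL2]; ring
  rw [hlhs] at key
  -- right-hand side: one term, `μ(g) ≤ 3`, `δ y = 2`
  have hsum : ∑ z ∈ ({y} : Finset (Site d)), c ^ min (ℓ y) (ℓ z) *
      (if z ∈ ({y} : Finset (Site d)) then 2 * 1 else 0) = 2 * c ^ ℓ y := by
    simp [mul_comm]
  have hg3' : ∫ s, (2 + a s) ∂μ ≤ 3 := by
    calc ∫ s, (2 + a s) ∂μ ≤ ∫ _s, (3 : ℝ) ∂μ :=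
          integral_mono ((integrable_const _).add hai) (integrable_const _) hg3
      _ = 3 := by simp
  have hc0 : 0 ≤ c := mul_nonneg (Nat.cast_nonneg _) (onDobrushinCoeff_nonneg β)
  calc |∫ s, a s * f s ∂μ - (∫ s, a s ∂μ) * ∫ s, f s ∂μ|
      ≤ (∫ s, (2 + a s) ∂μ) * ∑ z ∈ ({y} : Finset (Site d)), c ^ min (ℓ y) (ℓ z) *
          (if z ∈ ({y} : Finset (Site d)) then 2 * 1 else 0) := key
    _ = (∫ s, (2 + a s) ∂μ) * (2 * c ^ ℓ y) := by rw [hsum]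
    _ ≤ 3 * (2 * c ^ ℓ y) :=
        mul_le_mul_of_nonneg_right hg3' (mul_nonneg zero_le_two (pow_nonneg hc0 _))
    _ = 6 * c ^ ℓ y := by ring

/-- **Exponential decay of the truncated two-point function, sup-norm form**: under
`c := 2d (e^{4|β|} - 1) < 1` (and `0 < c`), with `m := -log c > 0`,
`|μ((s x)_i (s y)_j) - μ((s x)_i) μ((s y)_j)| ≤ 6 e^{-m ‖y - x‖}` for every Gibbs measure of the
O(N) model on `ℤ^d` (Georgii 2011, Cor. 8.32; Friedli–Velenik 2017, Thm. 6.31 / Example 6.36).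
[cite: Georgii2011, Cor. 8.32] -/
theorem abs_covariance_spin_le_exp (d : ℕ) {β : ℝ} (hc0 : 0 < (2 * d : ℕ) * onDobrushinCoeff β)
    (hc1 : (2 * d : ℕ) * onDobrushinCoeff β < 1)
    {μ : Measure (ONConfig (Site d) N)} (hμ : IsGibbsMeasure (onSpecification (zdGraph d) β) μ)
    (x y : Site d) (i j : Fin N) :
    |∫ s, (s x : EuclideanSpace ℝ (Fin N)) i * (s y : EuclideanSpace ℝ (Fin N)) j ∂μ -
        (∫ s, (s x : EuclideanSpace ℝ (Fin N)) i ∂μ) *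
          ∫ s, (s y : EuclideanSpace ℝ (Fin N)) j ∂μ| ≤
      6 * Real.exp (-(-Real.log ((2 * d : ℕ) * onDobrushinCoeff β)) * ‖y - x‖) := by
  refine (abs_covariance_spin_le d hc1.le hμ x y i j).trans ?_
  set c : ℝ := (2 * d : ℕ) * onDobrushinCoeff β with hc
  refine mul_le_mul_of_nonneg_left ?_ (by norm_num)
  rw [← Real.rpow_natCast, Real.rpow_def_of_pos hc0, neg_neg]
  refine Real.exp_le_exp.2 ?_
  exact mul_le_mul_of_nonpos_left (onCov_norm_sub_le_supDist x y) (Real.log_nonpos hc0.le hc1.le)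

end Zd

end Literature.Probability.LatticeModels
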